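import Summits.BirchSwinnertonDyer.BirchSwinnertonDyer.Theses.ShaPrimaryTransfer
import Summits.BirchSwinnertonDyer.BirchSwinnertonDyer.Theorems.ShaPrimaryTransferOneFiniteShaComponentKernelDoors
import Literature.NumberTheory.EllipticCurves.BSDSelmerCMPConverse
import Literature.NumberTheory.EllipticCurves.BSDSelmerParityDokchitserProofs
import Literature.NumberTheory.EllipticCurves.BSDSelmer

/-!
# BirchSwinnertonDyer / ShaPrimaryTransfer — crux `FiniteShaComponentTransfer` (stmt-BirchSwinnertonDyer-22356):
# T on the kernel-certified door families (rank 0, 1, 2 at the door prime 2)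

Route `ShaPrimaryTransfer` (D-0145 LINE 2): T = `FiniteShaComponentTransfer` («`t_p(E) = 0 ⟹ t_q(E) = 0`»,
`t_p(E) = corank_{ℤ_p} Ш(E)[p^∞]`). The companion file `…OneFiniteShaComponentKernelDoors` (route-independent, no
named fact) certifies the door at `2` in the kernel on: the CM family `E_p : y² = x³ + px`, `p ≡ 7, 11 (mod 16)`
(rank `0`), the CM curve `E_3 : y² = x³ + 3x` (rank `1`), Zywina's `E_{947,12}` (rank `2`). This helper file
(prover seat `bsd-line-spt-p1`, `--supports stmt-22356 --as helper`) reads T on exactly these curves: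

* §1 T's HYPOTHESIS, in the Selmer coordinates of `…RepairCensus` (`corank Sel_{p^∞} = rank` at the door prime), is
  KERNEL-CERTIFIED at every rank ≤ 2 (`exists_transfer_hypothesis_of_le_two`: for each `r ≤ 2` an elliptic `E/ℚ`
  with `rank = r`, `corank Sel_{2^∞}(E) = r`, `t_2(E) = 0`; unconditional). T's instances are therefore not
  vacuous at any rank ≤ 2; its conclusion («all `t_q = 0`», i.e. `Ш(E)` finite) is certified for none of them in
  the tree.
* §2 RANK 0 (the family `E_p`, `p ≡ 7, 11 (mod 16)`): T's conclusion holds modulo Burungale–Tian 2026 Thm. 1.1 (the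
  rank-zero `p`-converse for CM curves at ANY prime, here `p = 2`: `corank Sel_{2^∞}(E_p) = 0 ⟹ ord_{s=1} L = 0`)
  and Gross–Zagier–Kolyvagin (`Ш` finite): `shaCorank_xCubeAddPX_eq_zero_of_BT_GZK`. By-product: **rank-BSD for the
  family modulo BT2026 alone** — `rank E_p(ℚ) = 0` is a tree theorem (descent) and `ord_{s=1} L(E_p, s) = 0`
  follows from the kernel-certified `corank Sel_{2^∞}(E_p) = 0` (`analyticRank_xCubeAddPX_eq_zero_of_BT`,
  `rankBSD_xCubeAddPX_of_BT`); `Ш(E_p/ℚ)` finite modulo BT2026 + GZK (`finite_sha_xCubeAddPX_of_BT_GZK`).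
* §3 RANK 1 (`E_3`): an explicit, kernel-certified member of the RESIDUE CELL of T at algebraic rank 1 isolated in
  `…DoorCM.cm_residue_of_transfer_failure` — CM (`j = 1728`), rank `1`, door prime `2` (which divides
  `Δ(E_3) = −1728`: not a good prime, so no printed `2`-converse applies). Granting the analytic `p`-parity theorem
  at `2` (named fact `selmerCorank_mod_two_eq E_3 2`, Dokchitser–Dokchitser) `ord_{s=1} L(E_3, s)` is ODD
  (`odd_analyticRank_xCubeAddThreeX_of_parity`); T's conclusion for `E_3` follows from «`ord_{s=1} L(E_3,s) ≤ 1`»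
  + GZK (`shaCorank_xCubeAddThreeX_eq_zero_of_GZK`), i.e. from ONE numerical fact (`L'(E_3, 1) ≠ 0`) not in the
  tree; unconditionally in the tree T at `(E_3, 2, q)`, `q` odd, is open.
* §4 RANK 2 (`E_{947,12}`): T's first open cells, verbatim as for `E_{659,12}` in `…RankTwoDoor`: T ⟹
  `corank Sel_{q^∞}(E_{947,12}) = 2` at every prime `q` (`selmerCorank_zywina947_of_transfer`).

Nothing here proves T, O or BSD; T is conjecture-grade at rank ≥ 2. References: J. H. Silverman, *AEC* 2nd ed., X.6;
A. Burungale, Y. Tian, Ann. of Math. 203 (2026), Thm. 1.1; V. Kolyvagin (1990), Thm. A; T. and V. Dokchitser,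
Ann. of Math. 172 (2010), Thm. 1.4; D. Zywina, arXiv:2502.01957, Thm. 1.2; R. Greenberg, LNM 1716 (1999), §1.
-/

-- D-0017: single-problem summit, so `Summit.BirchSwinnertonDyer.BirchSwinnertonDyer.…` repeats a namespace BY DESIGN.
set_option linter.dupNamespace false

noncomputable section

namespace Summit.BirchSwinnertonDyer.BirchSwinnertonDyer.Theorems.ShaPrimaryTransferKernelFamilies

open scoped Classical
open Literature.NumberTheory.EllipticCurves Literature.NumberTheory.EllipticCurves.Zywina2025
open WeierstrassCurve
open Summit.BirchSwinnertonDyer.BirchSwinnertonDyer.Theses.ShaPrimaryTransfer (FiniteShaComponentTransfer)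
open Summit.BirchSwinnertonDyer.BirchSwinnertonDyer.Theorems.ShaPrimaryTransferKernelDoors

/-! ## §1 T's hypothesis is kernel-certified at every rank ≤ 2 -/

/-- **For every `r ≤ 2` there is an elliptic `E/ℚ` with `rank E(ℚ) = r`, `corank_{ℤ_2} Sel_{2^∞}(E/ℚ) = r` and
`t_2(E) = 0`** (the companion file's doors, read through Greenberg's identity `corank Sel = rank + t`, tree
`selmerCorank_eq_mordellWeilRank_add_holds`). UNCONDITIONAL: T's hypothesis — in `Ш`- and in Selmer coordinates —
is inhabited in the kernel at ranks `0, 1, 2`. [cite: SilvermanAEC2009, Cor. X.6.2.1] [cite: Zywina2025, Thm. 1.2]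
[cite: Greenberg1999LNM, §1 pp. 54–57] -/
theorem exists_transfer_hypothesis_of_le_two (r : ℕ) (hr : r ≤ 2) :
    ∃ W : WeierstrassCurve ℚ, W.IsElliptic ∧ W.mordellWeilRank = r ∧ W.selmerCorank 2 = r ∧
      W.shaCorank 2 = 0 := by
  obtain ⟨W, hW, hrk, h2⟩ := exists_door_at_two_of_le_two r hr
  haveI := hW
  haveI : Fact (Nat.Prime 2) := ⟨Nat.prime_two⟩
  have hid := W.selmerCorank_eq_mordellWeilRank_add_holds 2
  exact ⟨W, hW, hrk, by omega, h2⟩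

/-- **T is never vacuous at rank ≤ 2**: for each `r ≤ 2` some instance `(E, 2, q)` of T with `rank E(ℚ) = r` has a
TRUE hypothesis in the kernel, so T asserts `t_q(E) = 0` there for every prime `q` — certified in the tree for no
`E` of rank ≥ 2 and, at rank ≤ 1, only modulo named facts (§2, §3). [folklore] -/
theorem transfer_conclusion_on_kernel_doors (hT : FiniteShaComponentTransfer) (r : ℕ) (hr : r ≤ 2) :
    ∃ W : WeierstrassCurve ℚ, W.IsElliptic ∧ W.mordellWeilRank = r ∧
      ∀ (q : ℕ) [Fact q.Prime], W.shaCorank q = 0 := by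
  obtain ⟨W, hW, hrk, h2⟩ := exists_door_at_two_of_le_two r hr
  haveI := hW
  haveI : Fact (Nat.Prime 2) := ⟨Nat.prime_two⟩
  exact ⟨W, hW, hrk, fun q _ => hT W 2 q h2⟩

/-! ## §2 Rank 0: the family `E_p : y² = x³ + px`, `p ≡ 7, 11 (mod 16)` -/

/-- **`ord_{s=1} L(E_p, s) = 0` for `p ≡ 7, 11 (mod 16)`, modulo Burungale–Tian 2026 Thm. 1.1 alone**: `E_p` has
CM (`j = 1728`) and `corank_{ℤ_2} Sel_{2^∞}(E_p/ℚ) = 0` is kernel-certified (`selmerCorank_two_xCubeAddPX_eq_zero`),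
so the rank-zero `p`-converse for CM curves at the prime `2` gives `L(E_p, 1) ≠ 0`. CONDITIONAL on `hBT0` only.
[cite: BurungaleTian2026, Thm. 1.1] [cite: SilvermanAEC2009, Cor. X.6.2.1] -/
theorem analyticRank_xCubeAddPX_eq_zero_of_BT
    (hBT0 : burungaleTian_analyticRank_eq_zero_of_selmerCorank_eq_zero_of_hasCM)
    {p : ℕ} [Fact p.Prime] (h16 : p % 16 = 7 ∨ p % 16 = 11) :
    (⟨0, 0, 0, (p : ℚ), 0⟩ : WeierstrassCurve ℚ).analyticRank = 0 :=
  haveI := XCubeAddPX.isElliptic_px p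
  haveI : Fact (Nat.Prime 2) := ⟨Nat.prime_two⟩
  hBT0 _ (hasCM_xCubeAddPX p) 2 (selmerCorank_two_xCubeAddPX_eq_zero h16)

/-- **Rank-BSD for the family `E_p`, `p ≡ 7, 11 (mod 16)`, modulo BT2026 alone**: `rank E_p(ℚ) = 0` (tree, descent)
`= ord_{s=1} L(E_p, s)` (previous theorem). CONDITIONAL on `hBT0` only. [cite: BurungaleTian2026, Thm. 1.1]
[cite: SilvermanAEC2009, Cor. X.6.2.1] -/
theorem rankBSD_xCubeAddPX_of_BT (hBT0 : burungaleTian_analyticRank_eq_zero_of_selmerCorank_eq_zero_of_hasCM)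
    {p : ℕ} [Fact p.Prime] (h16 : p % 16 = 7 ∨ p % 16 = 11) :
    (⟨0, 0, 0, (p : ℚ), 0⟩ : WeierstrassCurve ℚ).mordellWeilRank =
      (⟨0, 0, 0, (p : ℚ), 0⟩ : WeierstrassCurve ℚ).analyticRank := by
  rw [(door_at_two_xCubeAddPX h16).1, analyticRank_xCubeAddPX_eq_zero_of_BT hBT0 h16]

/-- **`Ш(E_p/ℚ)` is finite for `p ≡ 7, 11 (mod 16)`, modulo BT2026 + Gross–Zagier–Kolyvagin** (analytic rank `0` by
the previous theorem; `hGZK`: `ord ≤ 1 ⟹ Ш` finite). CONDITIONAL on `hBT0`, `hGZK`.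
[cite: BurungaleTian2026, Thm. 1.1] [cite: Kolyvagin1990, Thm. A] -/
theorem finite_sha_xCubeAddPX_of_BT_GZK (hBT0 : burungaleTian_analyticRank_eq_zero_of_selmerCorank_eq_zero_of_hasCM)
    (hGZK : rank_eq_analyticRank_of_analyticRank_le_one) {p : ℕ} [Fact p.Prime]
    (h16 : p % 16 = 7 ∨ p % 16 = 11) : Finite ↥(⟨0, 0, 0, (p : ℚ), 0⟩ : WeierstrassCurve ℚ).sha :=
  haveI := XCubeAddPX.isElliptic_px p
  (hGZK _ (by rw [analyticRank_xCubeAddPX_eq_zero_of_BT hBT0 h16]; exact zero_le_one)).2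

/-- **T's conclusion on the rank-0 door family**: every `t_q(E_p) = 0`, `p ≡ 7, 11 (mod 16)`, modulo BT2026 + GZK —
the instance of `…Sectors.transfer_of_hasCM_of_mordellWeilRank_eq_zero` whose HYPOTHESES (`CM`, `rank 0`, `t_2 = 0`)
are now all tree theorems. CONDITIONAL on `hBT0`, `hGZK`. [cite: BurungaleTian2026, Thm. 1.1] [cite: Kolyvagin1990, Thm. A] -/
theorem shaCorank_xCubeAddPX_eq_zero_of_BT_GZK
    (hBT0 : burungaleTian_analyticRank_eq_zero_of_selmerCorank_eq_zero_of_hasCM)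
    (hGZK : rank_eq_analyticRank_of_analyticRank_le_one) {p : ℕ} [Fact p.Prime]
    (h16 : p % 16 = 7 ∨ p % 16 = 11) (q : ℕ) [Fact q.Prime] :
    (⟨0, 0, 0, (p : ℚ), 0⟩ : WeierstrassCurve ℚ).shaCorank q = 0 :=
  haveI := XCubeAddPX.isElliptic_px p
  haveI := finite_sha_xCubeAddPX_of_BT_GZK hBT0 hGZK h16
  shaCorank_eq_zero_of_finite _ q

/-- Hence `corank_{ℤ_q} Sel_{q^∞}(E_p/ℚ) = 0` at EVERY prime `q` (mod BT2026 + GZK): the Selmer-coordinate form of T's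
conclusion on the family. CONDITIONAL on `hBT0`, `hGZK`. [cite: BurungaleTian2026, Thm. 1.1] [cite: Greenberg1999LNM, §1 pp. 54–57] -/
theorem selmerCorank_xCubeAddPX_eq_zero_of_BT_GZK
    (hBT0 : burungaleTian_analyticRank_eq_zero_of_selmerCorank_eq_zero_of_hasCM)
    (hGZK : rank_eq_analyticRank_of_analyticRank_le_one) {p : ℕ} [Fact p.Prime]
    (h16 : p % 16 = 7 ∨ p % 16 = 11) (q : ℕ) [Fact q.Prime] :
    (⟨0, 0, 0, (p : ℚ), 0⟩ : WeierstrassCurve ℚ).selmerCorank q = 0 := by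
  haveI := XCubeAddPX.isElliptic_px p
  rw [WeierstrassCurve.selmerCorank_eq_mordellWeilRank_add_holds, (door_at_two_xCubeAddPX h16).1,
    shaCorank_xCubeAddPX_eq_zero_of_BT_GZK hBT0 hGZK h16 q]

/-! ## §3 Rank 1: `E_3 : y² = x³ + 3x`, an explicit member of the residue cell of T at rank 1 -/

/-- **The residue cell, inhabited in the kernel**: `E_3` has CM, `rank E_3(ℚ) = 1`, `t_2(E_3) = 0` and
`corank_{ℤ_2} Sel_{2^∞}(E_3) = 1` — all UNCONDITIONAL (companion file). The door prime `2` divides `Δ(E_3) = −1728`,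
so none of the printed `2`-converses (good ordinary / multiplicative hypotheses) applies: this is the CM rank-1
«`p < 5` or bad» cell of `…DoorCM.cm_residue_of_transfer_failure`, with an explicit witness.
[cite: SilvermanAEC2009, Prop. X.6.2(c), Rem. X.6.3] -/
theorem residue_cell_xCubeAddThreeX :
    (⟨0, 0, 0, ((3 : ℕ) : ℚ), 0⟩ : WeierstrassCurve ℚ).HasCM ∧
      (⟨0, 0, 0, ((3 : ℕ) : ℚ), 0⟩ : WeierstrassCurve ℚ).mordellWeilRank = 1 ∧
      (⟨0, 0, 0, ((3 : ℕ) : ℚ), 0⟩ : WeierstrassCurve ℚ).shaCorank 2 = 0 ∧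
      (⟨0, 0, 0, ((3 : ℕ) : ℚ), 0⟩ : WeierstrassCurve ℚ).selmerCorank 2 = 1 :=
  haveI : Fact (Nat.Prime 3) := ⟨Nat.prime_three⟩
  ⟨hasCM_xCubeAddPX 3, rank_eq_one_and_door_at_two_xCubeAddThreeX.1, rank_eq_one_and_door_at_two_xCubeAddThreeX.2,
    selmerCorank_two_xCubeAddThreeX_eq_one⟩

/-- **`ord_{s=1} L(E_3, s)` is odd**, granting the analytic `p`-parity theorem at `p = 2` (named fact
`selmerCorank_mod_two_eq E_3 2`: `corank Sel_{2^∞} ≡ ord_{s=1} L (mod 2)`, Dokchitser–Dokchitser 2010 Thm. 1.4):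
`corank Sel_{2^∞}(E_3) = 1` is kernel-certified. CONDITIONAL on `hpar`. [cite: DokchitserDokchitserAnnals2010, Thm. 1.4] -/
theorem odd_analyticRank_xCubeAddThreeX_of_parity
    (hpar : selmerCorank_mod_two_eq (⟨0, 0, 0, ((3 : ℕ) : ℚ), 0⟩ : WeierstrassCurve ℚ) 2) :
    (⟨0, 0, 0, ((3 : ℕ) : ℚ), 0⟩ : WeierstrassCurve ℚ).analyticRank % 2 = 1 := by
  have h : (⟨0, 0, 0, ((3 : ℕ) : ℚ), 0⟩ : WeierstrassCurve ℚ).selmerCorank 2 % 2 =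
      (⟨0, 0, 0, ((3 : ℕ) : ℚ), 0⟩ : WeierstrassCurve ℚ).analyticRank % 2 := hpar
  rw [selmerCorank_two_xCubeAddThreeX_eq_one] at h
  omega

/-- **T's conclusion for `E_3` follows from ONE numerical fact**: if `ord_{s=1} L(E_3, s) ≤ 1` (with `hpar` it is then
exactly `1`; numerically `L'(E_3, 1) ≠ 0`, not in the tree) then, granting Gross–Zagier–Kolyvagin, `Ш(E_3/ℚ)` is finite
and every `t_q(E_3) = 0`. CONDITIONAL on `hGZK` and the hypothesis `hr`. [cite: Kolyvagin1990, Thm. A] -/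
theorem shaCorank_xCubeAddThreeX_eq_zero_of_GZK (hGZK : rank_eq_analyticRank_of_analyticRank_le_one)
    (hr : (⟨0, 0, 0, ((3 : ℕ) : ℚ), 0⟩ : WeierstrassCurve ℚ).analyticRank ≤ 1) (q : ℕ) [Fact q.Prime] :
    (⟨0, 0, 0, ((3 : ℕ) : ℚ), 0⟩ : WeierstrassCurve ℚ).shaCorank q = 0 :=
  haveI := isElliptic_xCubeAddThreeX
  haveI := (hGZK _ hr).2
  shaCorank_eq_zero_of_finite _ q

/-- **What T asserts at `E_3`, by name**: granting T, the kernel-certified door `t_2(E_3) = 0` gives `t_q(E_3) = 0` at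
every prime `q` — for odd `q` a statement the tree cannot presently decide (no `L`-value of `E_3` is formalised).
CONDITIONAL on `hT`. [folklore] -/
theorem shaCorank_xCubeAddThreeX_eq_zero_of_transfer (hT : FiniteShaComponentTransfer) (q : ℕ) [Fact q.Prime] :
    (⟨0, 0, 0, ((3 : ℕ) : ℚ), 0⟩ : WeierstrassCurve ℚ).shaCorank q = 0 :=
  haveI := isElliptic_xCubeAddThreeX
  haveI : Fact (Nat.Prime 2) := ⟨Nat.prime_two⟩
  hT _ 2 q rank_eq_one_and_door_at_two_xCubeAddThreeX.2

/-! ## §4 Rank 2: `E_{947,12}`, T's first open cells -/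

/-- **T at rank 2, by name**: granting T, `corank_{ℤ_q} Sel_{q^∞}(E_{947,12}/ℚ) = 2` at EVERY prime `q` (door
`t_2 = 0` and `rank = 2` are tree theorems; Greenberg's identity). For `q` odd no theorem or computation in print
decides this instance. CONDITIONAL on `hT`. [cite: Zywina2025, Thm. 1.2] [cite: Greenberg1999LNM, §1 pp. 54–57] -/
theorem selmerCorank_zywina947_of_transfer (hT : FiniteShaComponentTransfer) (q : ℕ) [Fact q.Prime] :
    (zywinaCurve 947 12).selmerCorank q = 2 := by
  haveI := isElliptic_zywinaCurve zywinaAdmissible_947_12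
  haveI : Fact (Nat.Prime 2) := ⟨Nat.prime_two⟩
  have h0 : (zywinaCurve 947 12).shaCorank q = 0 :=
    hT _ 2 q (shaCorank_two_zywinaCurve zywinaAdmissible_947_12)
  rw [(zywinaCurve 947 12).selmerCorank_eq_mordellWeilRank_add_holds q, h0,
    mordellWeilRank_zywinaCurve zywinaAdmissible_947_12]

end Summit.BirchSwinnertonDyer.BirchSwinnertonDyer.Theorems.ShaPrimaryTransferKernelFamilies
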